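import Mathlib
import HarnessLib
import Summits.Langlands.Statement
import Summits.Langlands.Langlands.Theses.RootDecomp1
import Summits.Langlands.Langlands.Theorems.RootDecomp1SemisimpleAvatarOfSplit
import Literature.NumberTheory.Automorphic.AutomorphicRepsGLSatakeFlathProofs

/-!
# Node `CyclicDeinduction` (decomp-langlands · lens-3 «one certified translation + split beneath» · generation 17)

TARGET (BLOCKER FIRST): **G = `RootDecomp1.DarkPrimitiveAvatars`** (stmt-Langlands-29147 · crux r301 · OPEN · the DECLARED
RESIDUAL of the lens-6-g4 carving `AIDefectCarving` of E = `RootDecomp1.SemisimpleAvatar` 23598 on route-Langlands-RootDecomp1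
rev 4; never cut; BARRIER-certified `not_oddPairing_aiDefect_of_three_le ∧ not_chtCoincidenceGL_of_complexPlace`; first box of
record: n = 2, weight 0, COMPLEX CUBIC base field, non-monomial, non-base-change).  G says: every cuspidal L-algebraic π over a
number field K that is NOT «special» — special = member of the least class containing every automorphic representation over an
ACCESSIBLE field ([K:K⁺] ≤ 2) and saturated under the five moves (acc) / (up = twisted weak base change from a subfield) /
(down = one cuspidal weak base change to an overfield is special) / (ai = automorphic induction TO K from an overfield) / (dual)
— still has a semisimple ℓ-adic avatar at every (ℓ, ι).

THE ONE CERTIFIED TRANSLATION (lens-3's single EQUIV, kernel-checked below as `darkPrimitive_iff_pieces`, modulo the host's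
own five transports Acc/AvDesc/RTT/AIT/DT = RootDecomp1 items 29148–29152, cited BY NAME):

    G  ⟺  G⁺ ∧ UNMIX ∧ IND,      and exactly   E ⟺ G⁺ ∧ UNMIX ∧ IND ∧ Acc ∧ AvDesc ∧ RTT ∧ AIT ∧ DT   (`semisimpleAvatar_iff_pieces`).

The translation COMPLETES THE MOVE ALPHABET of the host dial to the full adjoint square of the two functorialities that exist
unconditionally on the Galois side — {base change, automorphic induction} × {easy transport, inverse transport}:
  · BC,  easy  = restriction of avatars            → host (up),   transport RTT 29150 (PRINT);
  · BC,  inverse = un-restricting (twist-class torsor) → host (down), transport AvDesc 29149 (the host's NEW ATOM, IDEA-NEEDED);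
  · AI,  easy  = induction of avatars              → host (ai),   transport AIT 29151 (PRINT);
  · AI,  inverse = UN-INDUCING along a CYCLIC layer K/K₀ (conjugate torsor) → NEW MOVE (ai↓) «if the automorphic induction of π
    DOWN to a subfield K₀ over which K is cyclic of prime degree is special, then π is special», whose transport is typed here as
    the pair IND (`InducedPreAvatar`: an avatar R of AI_{K/K₀}(π) over K₀ yields a PRE-AVATAR of π over K — a semisimple r whose
    induced Frobenius polynomials ∏_{w∣v} charpoly(r, Frob_w)(X^{f(w∣v)}) equal the ℓ-adic transport of π's induced Satake
    polynomials; PRINT-grade: R ≅ R ⊗ η by Chebotarev–Brauer–Nesbitt, Clifford theory in prime index, Mackey) and UNMIX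
    (`ConjugateUnmixing`: a pre-avatar can be UNMIXED into an avatar — the Galois partition {r^σ} of the Frobenius eigenvalues at
    the split places must be aligned with the automorphic partition {π^σ}; NEW ATOM, IDEA-NEEDED, the (A)-side dual of AvDesc).
With the sixth move the special class grows from «reachable from an accessible field by BC↑/AI↑/twist/dual» to «reachable by a
SOLVABLE LADDER»: every π over a field K some finite overfield of which descends to an accessible field through a tower of
cyclic prime layers (every field whose normal closure over some accessible subfield of an overfield is solvable: ALL cubic and
quartic fields, all pure fields ℚ(a^{1/n}), every S₃/S₄/dihedral-closure field, the complex cubic FIRST BOX of G itself) leaves the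
residual.  The new residual G⁺ = `InsolubleDarkAvatars` is G's statement with the enlarged dial: avatars for π outside the
6-move class — informally π over INSOLUBLY DARK fields ([K:K⁺] ≥ 3 and no solvable ladder to an accessible field: first box n = 2,
weight 0 over the S₅-quintic field of x⁵ − x − 1, signature (1,2)), plus nothing else (the degenerate layers — non-cuspidal
induction ⇔ π ≅ π^σ ⇔ π is a base change (Arthur–Clozel III.4.2), non-cuspidal base change ⇔ π ≅ π ⊗ η ⇔ π is induced — are
absorbed by the host's (up)/(ai) moves).

PIECES (each docstring-tagged; all necessity certificates kernel-checked in this file):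
  G⁺  `InsolubleDarkAvatars`  — crux r3 · WEAKER (`insolubleDark_of_darkPrimitive` : G → G⁺, `insolubleDark_of_semisimpleAvatar`)
      · DECLARED RESIDUAL of the lens-3-g17 line · leaf BARRIER (the two certificates of G persist verbatim on insolubly dark
      fields: ShimuraVarietyRealizationBarrier, no CHT coincidence at complex places) · STRICTLY SMALLER THAN G (G's own first
      box — complex cubic fields — is discharged to UNMIX ∧ AvDesc ∧ Acc by the ladder ℚ(∛2) ⊂ ℚ(∛2, ζ₃) ⟶(ai↓, cyclic cubic)
      ℚ(ζ₃) accessible).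
  UNMIX `ConjugateUnmixing`   — crux r2 · WEAKER (`unmixing_of_semisimpleAvatar` : E → UNMIX; Langlands-implied) · NEW ATOM ·
      leaf IDEA-NEEDED (no print mechanism aligns a Galois partition with an automorphic one without the (B) direction: the two
      known un-inducing devices — Jacquet–Shalika after relative descent (route ImaginaryQuadraticAnchor, AnchorAssembly 18738) and
      twist-averaged Rankin–Selberg inner products (route TwistAveragedDeinduction, TwistAverageExtraction 15712) — both consume
      reciprocity (B) over the small field; UNMIX asks it on the (A) side alone) · FIRST RUNG PROVED here
      (`preAvatar_compatible_of_unique_over`: a pre-avatar is already Satake–Frobenius compatible with π at every place of K that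
      is alone over K₀ — the unmixing content lives at the split places only; X ↦ X^p is injective on polynomials).
  IND `InducedPreAvatar`      — support r9 · WEAKER (`inducedPreAvatar_of_semisimpleAvatar` : E → IND) · leaf ATTACKABLE NOW
      (PRINT: Clifford 1937 / Curtis–Reiner §11C for the index-p normal subgroup Γ_K ◁ Γ_{K₀}; R ≅ R ⊗ η_{K/K₀} from the a.e.
      η-invariance of the induced Satake data by Chebotarev + Brauer–Nesbitt (tree: CharZeroDominance/IrreducibleOffSector carry the
      index-2 case); Mackey's formula for Frobenius polynomials of an induced representation; est. L).
  Acc 29148 / AvDesc 29149 (cruxes) and RTT 29150 / AIT 29151 / DT 29152 (supports): the host's items BY NAME (dedup), unchanged.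

`closes` : G⁺ → UNMIX → IND → Acc → AvDesc → RTT → AIT → DT → G is `darkPrimitive_of_semisimpleAvatar ∘ semisimpleAvatar_of_pieces`
(minimality of the 6-move class applied to «cuspidal L-algebraic members have semisimple avatars», saturated by the six transports;
outside the class G⁺ applies verbatim) — every binder load-bearing; `closes_root` threads E into RootDecomp1's Assembly by name.

WHY THIS IS NOVEL (searched: the 166 Theses of the sub, the cell bus ≤ L1252, COSTUME-CENSUS v22 §G/§K, `ledger negatives`):
no route types the DOWNWARD automorphic-induction transport on the (A) side without (B): RootDecomp1's dial has AI only upward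
(AIT 29151); ImaginaryQuadraticAnchor (N3, record-only) and TwistAveragedDeinduction (dormant) un-induce THROUGH reciprocity over
the small field (RelativeDescent 18736 is the (B)-side statement; TwistAverageExtraction 15712 takes `LanglandsOverQ`); the
(B)-side twins (DescentTypeTrichotomy DESC 29574 / PRIM 29575, InsolubleInductionCarving NIU 28044, SolvableReachSplit 29340) move
AUTOMORPHY along solvable layers by Arthur–Clozel descent, which has no (A)-side analogue — that missing analogue is exactly the
pair IND (provable) + UNMIX (atom).  Effect on the record: the dark residual of E shrinks from «AI-defect ≥ 3» to «insolubly dark».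
-/

set_option linter.dupNamespace false
set_option linter.unusedVariables false
set_option linter.style.longLine false

namespace Summit.Langlands.Langlands.Theorems.CyclicDeinduction

-- the gate's route-file context (RootDecomp1.lean ll. 369–370), so that the host texts elaborate byte-for-byte as there
open scoped BigOperators Topology Manifold Classical MeasureTheory ProbabilityTheory Matrix InnerProductSpace ComplexConjugate ContinuousMap
open Filter Set Function TopologicalSpace MeasureTheory
open Literature.NumberTheory.GaloisRepresentations Literature.NumberTheory.Automorphic
open IsDedekindDomain
open Summit.Langlands.Langlands.Theses
open scoped NumberField Polynomial

/-! ## The pieces (one-line `Prop`s; the texts are the route.json texts byte-for-byte) -/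

/-- **G⁺ = `InsolubleDarkAvatars`** — crux (rank 3) · DECLARED RESIDUAL · WEAKER (than G: `insolubleDark_of_darkPrimitive`;
than the summit: `insolubleDark_of_semisimpleAvatar`) · leaf BARRIER (ShimuraVarietyRealizationBarrier /
`not_oddPairing_aiDefect_of_three_le`, `not_chtCoincidenceGL_of_complexPlace` persist on insolubly dark fields) · STRICTLY
SMALLER than G (complex cubic and all solvable-ladder dark fields leave the residual).  Text = G's text with ONE MORE closure
clause in the dial (the sixth conjunct, move (ai↓)): the class must contain π over K whenever, for a subfield K₀ ⊆ K with K/K₀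
Galois, cyclic, of prime degree, some cuspidal L-algebraic a.e. automorphic induction of π to K₀ lies in the class. -/
def InsolubleDarkAvatars : Prop :=
  ∀ (K : Type) [Field K] [NumberField K] (n : ℕ) (hcpt : Literature.NumberTheory.Automorphic.isCompact_glFiniteIntegralLevel n K), 0 < n → ∀ (π : Literature.NumberTheory.Automorphic.CuspidalAutomorphicRepData n K hcpt), π.1.IsLAlgebraic → ¬ (∀ S : (∀ (K : Type) [Field K] [NumberField K] (n : ℕ) (hcpt : Literature.NumberTheory.Automorphic.isCompact_glFiniteIntegralLevel n K), Literature.NumberTheory.Automorphic.AutomorphicRepData (Literature.NumberTheory.Automorphic.AutomorphyDatum.gl n K hcpt) → Prop), ((∀ (K : Type) [Field K] [NumberField K] (n : ℕ) (hcpt : Literature.NumberTheory.Automorphic.isCompact_glFiniteIntegralLevel n K) (π : Literature.NumberTheory.Automorphic.AutomorphicRepData (Literature.NumberTheory.Automorphic.AutomorphyDatum.gl n K hcpt)), Module.finrank (NumberField.maximalRealSubfield K) K ≤ 2 → S K n hcpt π) ∧ (∀ (K₀ : Type) [Field K₀] [NumberField K₀] (M : Type) [Field M] [NumberField M] [Algebra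 K₀ M] (n : ℕ) (h₀ : Literature.NumberTheory.Automorphic.isCompact_glFiniteIntegralLevel n K₀) (hM : Literature.NumberTheory.Automorphic.isCompact_glFiniteIntegralLevel n M) (h₁ : Literature.NumberTheory.Automorphic.isCompact_glFiniteIntegralLevel 1 M) (π₀ : Literature.NumberTheory.Automorphic.CuspidalAutomorphicRepData n K₀ h₀) (χ : Literature.NumberTheory.Automorphic.AutomorphicRepData (Literature.NumberTheory.Automorphic.AutomorphyDatum.gl 1 M h₁)) (P : Literature.NumberTheory.Automorphic.AutomorphicRepData (Literature.NumberTheory.Automorphic.AutomorphyDatum.gl n M hM)), π₀.1.IsLAlgebraic → χ.IsLAlgebraic → (∀ᶠ w : IsDedekindDomain.HeightOneSpectrum (NumberField.RingOfIntegers M) in cofinite, ∀ (u : IsDedekindDomain.HeightOneSpectrum (NumberField.RingOfIntegers K₀)) (α : Multiset ℂ) (c : ℂ), w.asIdeal.under (NumberField.RingOfIntegers K₀) = u.asIdeal → π₀.1.HasSatakeParamAt u α → χ.HasSatakeParamAt w {c} → P.HasSatakeParamAt w ((α.map (· ^ w.asIdeal.inertiaDeg (NumberField.RingOfIntegers K₀))).map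 (c * ·))) → S K₀ n h₀ π₀.1 → S M n hM P) ∧ (∀ (K : Type) [Field K] [NumberField K] (M : Type) [Field M] [NumberField M] [Algebra K M] (n : ℕ) (hcpt : Literature.NumberTheory.Automorphic.isCompact_glFiniteIntegralLevel n K) (hM : Literature.NumberTheory.Automorphic.isCompact_glFiniteIntegralLevel n M) (π : Literature.NumberTheory.Automorphic.AutomorphicRepData (Literature.NumberTheory.Automorphic.AutomorphyDatum.gl n K hcpt)) (P : Literature.NumberTheory.Automorphic.CuspidalAutomorphicRepData n M hM), P.1.IsLAlgebraic → Literature.NumberTheory.Automorphic.IsWeakBaseChangeLiftAE π P.1 → S M n hM P.1 → S K n hcpt π) ∧ (∀ (K : Type) [Field K] [NumberField K] (L : Type) [Field L] [NumberField L] [Algebra K L] (m n : ℕ) (hL : Literature.NumberTheory.Automorphic.isCompact_glFiniteIntegralLevel m L) (hcpt : Literature.NumberTheory.Automorphic.isCompact_glFiniteIntegralLevel n K) (σ : Literature.NumberTheory.Automorphic.CuspidalAutomorphicRepData m L hL) (π : Literature.NumberTheory.Automorphic.AutomorphicRepData (Literature.NumberTheory.Automorphic.AutomorphyDatum.gl n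 K hcpt)), 0 < m → σ.1.IsLAlgebraic → (∀ᶠ v : IsDedekindDomain.HeightOneSpectrum (NumberField.RingOfIntegers K) in cofinite, ∀ β : IsDedekindDomain.HeightOneSpectrum (NumberField.RingOfIntegers L) → Multiset ℂ, (∀ w : IsDedekindDomain.HeightOneSpectrum (NumberField.RingOfIntegers L), w.asIdeal.under (NumberField.RingOfIntegers K) = v.asIdeal → σ.1.HasSatakeParamAt w (β w)) → ∃ α : Multiset ℂ, π.HasSatakeParamAt v α ∧ Literature.NumberTheory.Automorphic.satakePolynomial α = ∏ᶠ w ∈ {w : IsDedekindDomain.HeightOneSpectrum (NumberField.RingOfIntegers L) | w.asIdeal.under (NumberField.RingOfIntegers K) = v.asIdeal}, (Literature.NumberTheory.Automorphic.satakePolynomial (β w)).comp (Polynomial.X ^ w.asIdeal.inertiaDeg (NumberField.RingOfIntegers K))) → S L m hL σ.1 → S K n hcpt π) ∧ (∀ (K : Type) [Field K] [NumberField K] (n : ℕ) (hcpt : Literature.NumberTheory.Automorphic.isCompact_glFiniteIntegralLevel n K) (π : Literature.NumberTheory.Automorphic.CuspidalAutomorphicRepData n K hcpt) (P : Literature.NumberTheory.Automorphic.AutomorphicRepData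 (Literature.NumberTheory.Automorphic.AutomorphyDatum.gl n K hcpt)), π.1.IsLAlgebraic → (∀ᶠ v : IsDedekindDomain.HeightOneSpectrum (NumberField.RingOfIntegers K) in cofinite, ∀ α : Multiset ℂ, π.1.HasSatakeParamAt v α → P.HasSatakeParamAt v (α.map (·⁻¹))) → S K n hcpt π.1 → S K n hcpt P) ∧ (∀ (K₀ : Type) [Field K₀] [NumberField K₀] (K : Type) [Field K] [NumberField K] [Algebra K₀ K] (m n : ℕ) (hK : Literature.NumberTheory.Automorphic.isCompact_glFiniteIntegralLevel m K) (h₀ : Literature.NumberTheory.Automorphic.isCompact_glFiniteIntegralLevel n K₀) (π : Literature.NumberTheory.Automorphic.AutomorphicRepData (Literature.NumberTheory.Automorphic.AutomorphyDatum.gl m K hK)) (P : Literature.NumberTheory.Automorphic.CuspidalAutomorphicRepData n K₀ h₀), IsGalois K₀ K → IsCyclic (K ≃ₐ[K₀] K) → (Module.finrank K₀ K).Prime → 0 < n → P.1.IsLAlgebraic → (∀ᶠ v : IsDedekindDomain.HeightOneSpectrum (NumberField.RingOfIntegers K₀) in cofinite, ∀ β : IsDedekindDomain.HeightOneSpectrum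 (NumberField.RingOfIntegers K) → Multiset ℂ, (∀ w : IsDedekindDomain.HeightOneSpectrum (NumberField.RingOfIntegers K), w.asIdeal.under (NumberField.RingOfIntegers K₀) = v.asIdeal → π.HasSatakeParamAt w (β w)) → ∃ α : Multiset ℂ, P.1.HasSatakeParamAt v α ∧ Literature.NumberTheory.Automorphic.satakePolynomial α = ∏ᶠ w ∈ {w : IsDedekindDomain.HeightOneSpectrum (NumberField.RingOfIntegers K) | w.asIdeal.under (NumberField.RingOfIntegers K₀) = v.asIdeal}, (Literature.NumberTheory.Automorphic.satakePolynomial (β w)).comp (Polynomial.X ^ w.asIdeal.inertiaDeg (NumberField.RingOfIntegers K₀))) → S K₀ n h₀ P.1 → S K m hK π)) → S K n hcpt π.1) → ∀ (ℓ : ℕ) [Fact ℓ.Prime] (ι : PadicAlgCl ℓ ≃+* ℂ), ∃ ρ : Literature.NumberTheory.GaloisRepresentations.FramedGaloisRep K (PadicAlgCl ℓ) n, ρ.toGaloisRep.IsSemisimple ∧ ∀ᶠ v : IsDedekindDomain.HeightOneSpectrum (NumberField.RingOfIntegers K) in cofinite, SatakeFrobCompatibleAt ι π.1 ρ v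

/-- **IND = `InducedPreAvatar`** — support (rank 9) · WEAKER (`inducedPreAvatar_of_semisimpleAvatar`) · leaf ATTACKABLE NOW ·
PRINT-grade (Clifford theory in prime index + Chebotarev/Brauer–Nesbitt for R ≅ R ⊗ η + Mackey; est. L).  For K/K₀ cyclic of
prime degree, π cuspidal L-algebraic on GL_m/K, P cuspidal L-algebraic on GL_n/K₀ an a.e. automorphic induction of π (the host's
Arthur–Clozel Def. 6.1 clause, verbatim with the roles L ↦ K, K ↦ K₀), and R a semisimple a.e. avatar of P: there is a
PRE-AVATAR of π — a semisimple r : Γ_K → GL_m(ℚ̄_ℓ) such that above a.e. place v of K₀ the induced Frobenius polynomial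
∏_{w∣v} charpoly(r, Frob_w)(X^{f(w∣v)}) equals ∏_{w∣v} P^{ι}_{π,w}(X^{f(w∣v)}) (P^{ι}_{π,w} = `arithFrobPolyOfSatake ι q_w 1 α_w`).
The witness intended is r = R|_{Γ_K}'s Clifford constituent-sum with R ≅ Ind r. -/
def InducedPreAvatar : Prop :=
  ∀ (K₀ : Type) [Field K₀] [NumberField K₀] (K : Type) [Field K] [NumberField K] [Algebra K₀ K], IsGalois K₀ K → IsCyclic (K ≃ₐ[K₀] K) → (Module.finrank K₀ K).Prime → ∀ (m n : ℕ) (hK : Literature.NumberTheory.Automorphic.isCompact_glFiniteIntegralLevel m K) (h₀ : Literature.NumberTheory.Automorphic.isCompact_glFiniteIntegralLevel n K₀), 0 < m → 0 < n → ∀ (π : Literature.NumberTheory.Automorphic.CuspidalAutomorphicRepData m K hK) (P : Literature.NumberTheory.Automorphic.CuspidalAutomorphicRepData n K₀ h₀), π.1.IsLAlgebraic → P.1.IsLAlgebraic → (∀ᶠ v : IsDedekindDomain.HeightOneSpectrum (NumberField.RingOfIntegers K₀) in cofinite, ∀ β : IsDedekindDomain.HeightOneSpectrum (NumberField.RingOfIntegers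 K) → Multiset ℂ, (∀ w : IsDedekindDomain.HeightOneSpectrum (NumberField.RingOfIntegers K), w.asIdeal.under (NumberField.RingOfIntegers K₀) = v.asIdeal → π.1.HasSatakeParamAt w (β w)) → ∃ α : Multiset ℂ, P.1.HasSatakeParamAt v α ∧ Literature.NumberTheory.Automorphic.satakePolynomial α = ∏ᶠ w ∈ {w : IsDedekindDomain.HeightOneSpectrum (NumberField.RingOfIntegers K) | w.asIdeal.under (NumberField.RingOfIntegers K₀) = v.asIdeal}, (Literature.NumberTheory.Automorphic.satakePolynomial (β w)).comp (Polynomial.X ^ w.asIdeal.inertiaDeg (NumberField.RingOfIntegers K₀))) → ∀ (ℓ : ℕ) [Fact ℓ.Prime] (ι : PadicAlgCl ℓ ≃+* ℂ) (R : Literature.NumberTheory.GaloisRepresentations.FramedGaloisRep K₀ (PadicAlgCl ℓ) n), R.toGaloisRep.IsSemisimple → (∀ᶠ v : IsDedekindDomain.HeightOneSpectrum (NumberField.RingOfIntegers K₀) in cofinite, SatakeFrobCompatibleAt ι P.1 R v) → ∃ r : Literature.NumberTheory.GaloisRepresentations.FramedGaloisRep K (PadicAlgCl ℓ) m, r.toGaloisRep.IsSemisimple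 ∧ (∀ᶠ v : IsDedekindDomain.HeightOneSpectrum (NumberField.RingOfIntegers K₀) in cofinite, ∀ β : IsDedekindDomain.HeightOneSpectrum (NumberField.RingOfIntegers K) → Multiset ℂ, (∀ w : IsDedekindDomain.HeightOneSpectrum (NumberField.RingOfIntegers K), w.asIdeal.under (NumberField.RingOfIntegers K₀) = v.asIdeal → π.1.HasSatakeParamAt w (β w)) → ∃ Q : IsDedekindDomain.HeightOneSpectrum (NumberField.RingOfIntegers K) → Polynomial (PadicAlgCl ℓ), (∀ w : IsDedekindDomain.HeightOneSpectrum (NumberField.RingOfIntegers K), w.asIdeal.under (NumberField.RingOfIntegers K₀) = v.asIdeal → r.IsUnramifiedAt w ∧ r.HasFrobCharpolyAt w (Q w)) ∧ ∏ᶠ w ∈ {w : IsDedekindDomain.HeightOneSpectrum (NumberField.RingOfIntegers K) | w.asIdeal.under (NumberField.RingOfIntegers K₀) = v.asIdeal}, (Q w).comp (Polynomial.X ^ w.asIdeal.inertiaDeg (NumberField.RingOfIntegers K₀)) = ∏ᶠ w ∈ {w : IsDedekindDomain.HeightOneSpectrum (NumberField.RingOfIntegers K) | w.asIdeal.under (NumberField.RingOfIntegers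 K₀) = v.asIdeal}, (Literature.NumberTheory.Automorphic.arithFrobPolyOfSatake ι w.residueCard 1 (β w)).comp (Polynomial.X ^ w.asIdeal.inertiaDeg (NumberField.RingOfIntegers K₀)))

/-- **UNMIX = `ConjugateUnmixing`** — crux (rank 2) · NEW ATOM · WEAKER (`unmixing_of_semisimpleAvatar`; Langlands-implied,
not known to imply anything on the record) · leaf IDEA-NEEDED · first rung PROVED (`preAvatar_compatible_of_unique_over`).
For K/K₀ cyclic of prime degree and π cuspidal L-algebraic on GL_m/K: a pre-avatar of π (see IND) can be unmixed — π has a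
semisimple a.e. avatar over K.  Content: at a place v of K₀ split in K the pre-avatar identity only says that the multiset
⋃_σ eig r(Frob_{σw}) equals ⋃_σ roots P^{ι}_{π,σw}; aligning the Galois partition (σ ↦ r^σ) with the automorphic one (σ ↦ π^σ) at
almost all split places is the (A)-side dual of the host's single-layer descent AvDesc (un-restricting ↔ un-inducing).
WHY IT MIGHT FAIL AS A LEMMA: Frobenius-interlacing of the conjugates r^σ is not excluded by any density/rigidity statement on
record (dihedral examples show trace coincidences on whole cosets); every un-inducing device in print uses direction (B). -/
def ConjugateUnmixing : Prop :=
  ∀ (K₀ : Type) [Field K₀] [NumberField K₀] (K : Type) [Field K] [NumberField K] [Algebra K₀ K], IsGalois K₀ K → IsCyclic (K ≃ₐ[K₀] K) → (Module.finrank K₀ K).Prime → ∀ (m : ℕ) (hK : Literature.NumberTheory.Automorphic.isCompact_glFiniteIntegralLevel m K), 0 < m → ∀ (π : Literature.NumberTheory.Automorphic.CuspidalAutomorphicRepData m K hK), π.1.IsLAlgebraic → ∀ (ℓ : ℕ) [Fact ℓ.Prime] (ι : PadicAlgCl ℓ ≃+* ℂ), (∃ r : Literature.NumberTheory.GaloisRepresentations.FramedGaloisRep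 K (PadicAlgCl ℓ) m, r.toGaloisRep.IsSemisimple ∧ (∀ᶠ v : IsDedekindDomain.HeightOneSpectrum (NumberField.RingOfIntegers K₀) in cofinite, ∀ β : IsDedekindDomain.HeightOneSpectrum (NumberField.RingOfIntegers K) → Multiset ℂ, (∀ w : IsDedekindDomain.HeightOneSpectrum (NumberField.RingOfIntegers K), w.asIdeal.under (NumberField.RingOfIntegers K₀) = v.asIdeal → π.1.HasSatakeParamAt w (β w)) → ∃ Q : IsDedekindDomain.HeightOneSpectrum (NumberField.RingOfIntegers K) → Polynomial (PadicAlgCl ℓ), (∀ w : IsDedekindDomain.HeightOneSpectrum (NumberField.RingOfIntegers K), w.asIdeal.under (NumberField.RingOfIntegers K₀) = v.asIdeal → r.IsUnramifiedAt w ∧ r.HasFrobCharpolyAt w (Q w)) ∧ ∏ᶠ w ∈ {w : IsDedekindDomain.HeightOneSpectrum (NumberField.RingOfIntegers K) | w.asIdeal.under (NumberField.RingOfIntegers K₀) = v.asIdeal}, (Q w).comp (Polynomial.X ^ w.asIdeal.inertiaDeg (NumberField.RingOfIntegers K₀)) = ∏ᶠ w ∈ {w : IsDedekindDomain.HeightOneSpectrum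 (NumberField.RingOfIntegers K) | w.asIdeal.under (NumberField.RingOfIntegers K₀) = v.asIdeal}, (Literature.NumberTheory.Automorphic.arithFrobPolyOfSatake ι w.residueCard 1 (β w)).comp (Polynomial.X ^ w.asIdeal.inertiaDeg (NumberField.RingOfIntegers K₀)))) → ∃ ρ : Literature.NumberTheory.GaloisRepresentations.FramedGaloisRep K (PadicAlgCl ℓ) m, ρ.toGaloisRep.IsSemisimple ∧ ∀ᶠ w : IsDedekindDomain.HeightOneSpectrum (NumberField.RingOfIntegers K) in cofinite, SatakeFrobCompatibleAt ι π.1 ρ w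

/-- Assembly of the child route (refines RootDecomp1:DarkPrimitiveAvatars): the three new pieces and the host's five transports
BY NAME imply G.  Proved below (`closes`). -/
def Assembly : Prop :=
  InsolubleDarkAvatars → ConjugateUnmixing → InducedPreAvatar → RootDecomp1.AccessibleAvatars → RootDecomp1.AvatarDescent → RootDecomp1.RestrictionTwistTransport → RootDecomp1.InductionTransport → RootDecomp1.DualTransport → RootDecomp1.DarkPrimitiveAvatars

/-! ## Bookkeeping: cofinite sets of places along a finite layer -/

/-- If a property holds at all but finitely many places of K, then for all but finitely many places v of K₀ it holds at EVERY
place of K above v (the bad v are the images of the bad w under `HeightOneSpectrum.under`). -/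
theorem eventually_forall_over {K₀ K : Type} [Field K₀] [NumberField K₀] [Field K] [NumberField K] [Algebra K₀ K]
    {p : HeightOneSpectrum (𝓞 K) → Prop} (h : ∀ᶠ w in cofinite, p w) :
    ∀ᶠ v : HeightOneSpectrum (𝓞 K₀) in cofinite,
      ∀ w : HeightOneSpectrum (𝓞 K), w.asIdeal.under (𝓞 K₀) = v.asIdeal → p w := by
  rw [Filter.eventually_cofinite] at h ⊢
  refine (h.image (HeightOneSpectrum.under (𝓞 K₀))).subset ?_
  intro v hv
  simp only [Set.mem_setOf_eq] at hv
  push Not at hv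
  obtain ⟨w, hw, hpw⟩ := hv
  exact ⟨w, hpw, HeightOneSpectrum.ext (by rw [HeightOneSpectrum.under_asIdeal]; exact hw)⟩

/-- A conditional finite product over a uniquely satisfied condition is its single factor. -/
theorem finprod_cond_eq_single {α M : Type*} [CommMonoid M] {p : α → Prop} (w : α) (hw : p w)
    (huniq : ∀ w', p w' → w' = w) (F : α → M) : (∏ᶠ (w') (_ : p w'), F w') = F w := by
  classical
  rw [finprod_eq_single (fun w' => ∏ᶠ (_ : p w'), F w') w]
  · rw [finprod_eq_if, if_pos hw]
  · intro x hx
    rw [finprod_eq_if, if_neg (fun hx' => hx (huniq x hx'))]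

/-! ## Necessity certificates (every piece is implied by E = `RootDecomp1.SemisimpleAvatar`, hence by the summit) -/

/-- E ⇒ G⁺ (ignore the dial). -/
theorem insolubleDark_of_semisimpleAvatar (hE : RootDecomp1.SemisimpleAvatar) : InsolubleDarkAvatars := by
  intro K _ _ n hcpt hn π hπ _ ℓ _ ι
  exact hE K n hcpt hn π hπ ℓ ι

/-- **G ⇒ G⁺**: the 6-move class contains the 5-move class, so its complement is smaller. -/
theorem insolubleDark_of_darkPrimitive (hG : RootDecomp1.DarkPrimitiveAvatars) : InsolubleDarkAvatars := by
  intro K _ _ n hcpt hn π hπ hns ℓ _ ι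
  refine hG K n hcpt hn π hπ ?_ ℓ ι
  intro hsp
  exact hns (fun S hS => hsp S ⟨hS.1, hS.2.1, hS.2.2.1, hS.2.2.2.1, hS.2.2.2.2.1⟩)

/-- E ⇒ G (the host residual is of course implied by its parent). -/
theorem darkPrimitive_of_semisimpleAvatar (hE : RootDecomp1.SemisimpleAvatar) : RootDecomp1.DarkPrimitiveAvatars := by
  intro K _ _ n hcpt hn π hπ _ ℓ _ ι
  exact hE K n hcpt hn π hπ ℓ ι

/-- E ⇒ IND: the avatar of π itself is a pre-avatar (Q_w := P^{ι}_{π,w}; the identity is `rfl`; uniqueness of Satake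
parameters, Flath). -/
theorem inducedPreAvatar_of_semisimpleAvatar (hE : RootDecomp1.SemisimpleAvatar) : InducedPreAvatar := by
  intro K₀ _ _ K _ _ _ hGal hCyc hPr m n hK h₀ hm hn π P hπL hPL hAI ℓ _ ι R hRss hR
  obtain ⟨ρ, hρss, hρ⟩ := hE K m hK hm π hπL ℓ ι
  refine ⟨ρ, hρss, ?_⟩
  filter_upwards [eventually_forall_over (K₀ := K₀) hρ] with v hv
  intro β hβ
  refine ⟨fun w => arithFrobPolyOfSatake ι w.residueCard 1 (β w), ?_, rfl⟩
  intro w hw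
  obtain ⟨α, hα, hur, hch⟩ := hv w hw
  have hαβ : α = β w := AutomorphicRepData.hasSatakeParamAt_unique_holds π.1 hα (hβ w hw)
  subst hαβ
  exact ⟨hur, hch⟩

/-- E ⇒ UNMIX (the conclusion of UNMIX is E's). -/
theorem unmixing_of_semisimpleAvatar (hE : RootDecomp1.SemisimpleAvatar) : ConjugateUnmixing := by
  intro K₀ _ _ K _ _ _ _ _ _ m hK hm π hπL ℓ _ ι _
  exact hE K m hK hm π hπL ℓ ι

/-- E ⇒ Acc. -/
theorem accessible_of_semisimpleAvatar (hE : RootDecomp1.SemisimpleAvatar) : RootDecomp1.AccessibleAvatars := by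
  intro K _ _ n hcpt hn _ π hπ ℓ _ ι
  exact hE K n hcpt hn π hπ ℓ ι

/-- E ⇒ AvDesc. -/
theorem avatarDescent_of_semisimpleAvatar (hE : RootDecomp1.SemisimpleAvatar) : RootDecomp1.AvatarDescent := by
  intro K _ _ n hcpt hn π hπ M _ _ _ hM P hPL hBC ℓ _ ι r _ _
  exact hE K n hcpt hn π hπ ℓ ι

/-- E ⇒ RTT. -/
theorem restrictionTwist_of_semisimpleAvatar (hE : RootDecomp1.SemisimpleAvatar) : RootDecomp1.RestrictionTwistTransport := by
  intro K₀ _ _ M _ _ _ n h₀ hM h₁ hn π₀ χ P hπ₀ hχ hPL htw ℓ _ ι ρ₀ _ _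
  exact hE M n hM hn P hPL ℓ ι

/-- E ⇒ AIT. -/
theorem induction_of_semisimpleAvatar (hE : RootDecomp1.SemisimpleAvatar) : RootDecomp1.InductionTransport := by
  intro K _ _ L _ _ _ m n hL hcpt hm hn σ π hσL hπL hAI ℓ _ ι r _ _
  exact hE K n hcpt hn π hπL ℓ ι

/-- E ⇒ DT. -/
theorem dual_of_semisimpleAvatar (hE : RootDecomp1.SemisimpleAvatar) : RootDecomp1.DualTransport := by
  intro K _ _ n hcpt hn π P hπL hPL hdual ℓ _ ι ρ _ _
  exact hE K n hcpt hn P hPL ℓ ι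

/-! ## The split: the six transports saturate «cuspidal L-algebraic members have semisimple avatars» -/

/-- **Pieces ⇒ E.**  By cases on the 6-move dial «π is special⁺»: if special⁺, apply the defining minimality of the least
saturated class to `A K n hcpt π := (0 < n → π cuspidal → π L-algebraic → avatars at every ℓ, ι)`, whose six closure properties
are exactly Acc, RTT, AvDesc, AIT, DT and — the new one — IND followed by UNMIX; if not special⁺, G⁺ applies verbatim. -/
theorem semisimpleAvatar_of_pieces (hG : InsolubleDarkAvatars) (hU : ConjugateUnmixing) (hInd : InducedPreAvatar)
    (hAcc : RootDecomp1.AccessibleAvatars) (hD : RootDecomp1.AvatarDescent) (hT : RootDecomp1.RestrictionTwistTransport)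
    (hI : RootDecomp1.InductionTransport) (hV : RootDecomp1.DualTransport) : RootDecomp1.SemisimpleAvatar := by
  intro K _ _ n hcpt hn π hπ ℓ _ ι
  by_cases hsp : (∀ S : (∀ (K : Type) [Field K] [NumberField K] (n : ℕ) (hcpt : Literature.NumberTheory.Automorphic.isCompact_glFiniteIntegralLevel n K), Literature.NumberTheory.Automorphic.AutomorphicRepData (Literature.NumberTheory.Automorphic.AutomorphyDatum.gl n K hcpt) → Prop), ((∀ (K : Type) [Field K] [NumberField K] (n : ℕ) (hcpt : Literature.NumberTheory.Automorphic.isCompact_glFiniteIntegralLevel n K) (π : Literature.NumberTheory.Automorphic.AutomorphicRepData (Literature.NumberTheory.Automorphic.AutomorphyDatum.gl n K hcpt)), Module.finrank (NumberField.maximalRealSubfield K) K ≤ 2 → S K n hcpt π) ∧ (∀ (K₀ : Type) [Field K₀] [NumberField K₀] (M : Type) [Field M] [NumberField M] [Algebra K₀ M] (n : ℕ) (h₀ : Literature.NumberTheory.Automorphic.isCompact_glFiniteIntegralLevel n K₀) (hM : Literature.NumberTheory.Automorphic.isCompact_glFiniteIntegralLevel n M) (h₁ : Literature.NumberTheory.Automorphic.isCompact_glFiniteIntegralLevel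 1 M) (π₀ : Literature.NumberTheory.Automorphic.CuspidalAutomorphicRepData n K₀ h₀) (χ : Literature.NumberTheory.Automorphic.AutomorphicRepData (Literature.NumberTheory.Automorphic.AutomorphyDatum.gl 1 M h₁)) (P : Literature.NumberTheory.Automorphic.AutomorphicRepData (Literature.NumberTheory.Automorphic.AutomorphyDatum.gl n M hM)), π₀.1.IsLAlgebraic → χ.IsLAlgebraic → (∀ᶠ w : IsDedekindDomain.HeightOneSpectrum (NumberField.RingOfIntegers M) in cofinite, ∀ (u : IsDedekindDomain.HeightOneSpectrum (NumberField.RingOfIntegers K₀)) (α : Multiset ℂ) (c : ℂ), w.asIdeal.under (NumberField.RingOfIntegers K₀) = u.asIdeal → π₀.1.HasSatakeParamAt u α → χ.HasSatakeParamAt w {c} → P.HasSatakeParamAt w ((α.map (· ^ w.asIdeal.inertiaDeg (NumberField.RingOfIntegers K₀))).map (c * ·))) → S K₀ n h₀ π₀.1 → S M n hM P) ∧ (∀ (K : Type) [Field K] [NumberField K] (M : Type) [Field M] [NumberField M] [Algebra K M] (n : ℕ) (hcpt : Literature.NumberTheory.Automorphic.isCompact_glFiniteIntegralLevel n K) (hM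 : Literature.NumberTheory.Automorphic.isCompact_glFiniteIntegralLevel n M) (π : Literature.NumberTheory.Automorphic.AutomorphicRepData (Literature.NumberTheory.Automorphic.AutomorphyDatum.gl n K hcpt)) (P : Literature.NumberTheory.Automorphic.CuspidalAutomorphicRepData n M hM), P.1.IsLAlgebraic → Literature.NumberTheory.Automorphic.IsWeakBaseChangeLiftAE π P.1 → S M n hM P.1 → S K n hcpt π) ∧ (∀ (K : Type) [Field K] [NumberField K] (L : Type) [Field L] [NumberField L] [Algebra K L] (m n : ℕ) (hL : Literature.NumberTheory.Automorphic.isCompact_glFiniteIntegralLevel m L) (hcpt : Literature.NumberTheory.Automorphic.isCompact_glFiniteIntegralLevel n K) (σ : Literature.NumberTheory.Automorphic.CuspidalAutomorphicRepData m L hL) (π : Literature.NumberTheory.Automorphic.AutomorphicRepData (Literature.NumberTheory.Automorphic.AutomorphyDatum.gl n K hcpt)), 0 < m → σ.1.IsLAlgebraic → (∀ᶠ v : IsDedekindDomain.HeightOneSpectrum (NumberField.RingOfIntegers K) in cofinite, ∀ β : IsDedekindDomain.HeightOneSpectrum (NumberField.RingOfIntegers L) → Multiset ℂ, (∀ w :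 IsDedekindDomain.HeightOneSpectrum (NumberField.RingOfIntegers L), w.asIdeal.under (NumberField.RingOfIntegers K) = v.asIdeal → σ.1.HasSatakeParamAt w (β w)) → ∃ α : Multiset ℂ, π.HasSatakeParamAt v α ∧ Literature.NumberTheory.Automorphic.satakePolynomial α = ∏ᶠ w ∈ {w : IsDedekindDomain.HeightOneSpectrum (NumberField.RingOfIntegers L) | w.asIdeal.under (NumberField.RingOfIntegers K) = v.asIdeal}, (Literature.NumberTheory.Automorphic.satakePolynomial (β w)).comp (Polynomial.X ^ w.asIdeal.inertiaDeg (NumberField.RingOfIntegers K))) → S L m hL σ.1 → S K n hcpt π) ∧ (∀ (K : Type) [Field K] [NumberField K] (n : ℕ) (hcpt : Literature.NumberTheory.Automorphic.isCompact_glFiniteIntegralLevel n K) (π : Literature.NumberTheory.Automorphic.CuspidalAutomorphicRepData n K hcpt) (P : Literature.NumberTheory.Automorphic.AutomorphicRepData (Literature.NumberTheory.Automorphic.AutomorphyDatum.gl n K hcpt)), π.1.IsLAlgebraic → (∀ᶠ v : IsDedekindDomain.HeightOneSpectrum (NumberField.RingOfIntegers K) in cofinite, ∀ α : Multiset ℂ,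 π.1.HasSatakeParamAt v α → P.HasSatakeParamAt v (α.map (·⁻¹))) → S K n hcpt π.1 → S K n hcpt P) ∧ (∀ (K₀ : Type) [Field K₀] [NumberField K₀] (K : Type) [Field K] [NumberField K] [Algebra K₀ K] (m n : ℕ) (hK : Literature.NumberTheory.Automorphic.isCompact_glFiniteIntegralLevel m K) (h₀ : Literature.NumberTheory.Automorphic.isCompact_glFiniteIntegralLevel n K₀) (π : Literature.NumberTheory.Automorphic.AutomorphicRepData (Literature.NumberTheory.Automorphic.AutomorphyDatum.gl m K hK)) (P : Literature.NumberTheory.Automorphic.CuspidalAutomorphicRepData n K₀ h₀), IsGalois K₀ K → IsCyclic (K ≃ₐ[K₀] K) → (Module.finrank K₀ K).Prime → 0 < n → P.1.IsLAlgebraic → (∀ᶠ v : IsDedekindDomain.HeightOneSpectrum (NumberField.RingOfIntegers K₀) in cofinite, ∀ β : IsDedekindDomain.HeightOneSpectrum (NumberField.RingOfIntegers K) → Multiset ℂ, (∀ w : IsDedekindDomain.HeightOneSpectrum (NumberField.RingOfIntegers K), w.asIdeal.under (NumberField.RingOfIntegers K₀) = v.asIdeal → π.HasSatakeParamAt w (β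 w)) → ∃ α : Multiset ℂ, P.1.HasSatakeParamAt v α ∧ Literature.NumberTheory.Automorphic.satakePolynomial α = ∏ᶠ w ∈ {w : IsDedekindDomain.HeightOneSpectrum (NumberField.RingOfIntegers K) | w.asIdeal.under (NumberField.RingOfIntegers K₀) = v.asIdeal}, (Literature.NumberTheory.Automorphic.satakePolynomial (β w)).comp (Polynomial.X ^ w.asIdeal.inertiaDeg (NumberField.RingOfIntegers K₀))) → S K₀ n h₀ P.1 → S K m hK π)) → S K n hcpt π.1)
  · refine hsp
      (fun K _ _ n hcpt π => 0 < n → π.W ≤ Literature.NumberTheory.Automorphic.cuspFormsGL n K hcpt → π.IsLAlgebraic → ∀ (ℓ : ℕ) [Fact ℓ.Prime] (ι : PadicAlgCl ℓ ≃+* ℂ), ∃ ρ : Literature.NumberTheory.GaloisRepresentations.FramedGaloisRep K (PadicAlgCl ℓ) n, ρ.toGaloisRep.IsSemisimple ∧ ∀ᶠ v : IsDedekindDomain.HeightOneSpectrum (NumberField.RingOfIntegers K) in cofinite, SatakeFrobCompatibleAt ι π ρ v)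
      ⟨?_, ?_, ?_, ?_, ?_, ?_⟩ hn π.2 hπ ℓ ι
    · intro K _ _ n hcpt π hK hn hc hL ℓ _ ι
      exact hAcc K n hcpt hn hK ⟨π, hc⟩ hL ℓ ι
    · intro K₀ _ _ M _ _ _ n h₀ hM h₁ π₀ χ P hπ₀L hχL htw ih hn hPc hPL ℓ _ ι
      obtain ⟨ρ₀, hρ₀ss, hρ₀⟩ := ih hn π₀.2 hπ₀L ℓ ι
      exact hT K₀ M n h₀ hM h₁ hn π₀ χ ⟨P, hPc⟩ hπ₀L hχL hPL htw ℓ ι ρ₀ hρ₀ss hρ₀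
    · intro K _ _ M _ _ _ n hcpt hM π P hPL hBC ih hn hc hπL ℓ _ ι
      obtain ⟨r, hrss, hr⟩ := ih hn P.2 hPL ℓ ι
      exact hD K n hcpt hn ⟨π, hc⟩ hπL M hM P hPL hBC ℓ ι r hrss hr
    · intro K _ _ L _ _ _ m n hL hcpt σ π hm hσL hAI ih hn hc hπL ℓ _ ι
      obtain ⟨r, hrss, hr⟩ := ih hm σ.2 hσL ℓ ι
      exact hI K L m n hL hcpt hm hn σ ⟨π, hc⟩ hσL hπL hAI ℓ ι r hrss hr
    · intro K _ _ n hcpt π P hπL hdual ih hn hc hPL ℓ _ ι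
      obtain ⟨ρ, hρss, hρ⟩ := ih hn π.2 hπL ℓ ι
      exact hV K n hcpt hn π ⟨P, hc⟩ hπL hPL hdual ℓ ι ρ hρss hρ
    · intro K₀ _ _ K _ _ _ m n hK h₀ π P hGal hCyc hPr hn hPL hAI ih hm hc hπL ℓ _ ι
      obtain ⟨R, hRss, hR⟩ := ih hn P.2 hPL ℓ ι
      obtain ⟨r, hrss, hr⟩ := hInd K₀ K hGal hCyc hPr m n hK h₀ hm hn ⟨π, hc⟩ P hπL hPL hAI ℓ ι R hRss hR
      exact hU K₀ K hGal hCyc hPr m hK hm ⟨π, hc⟩ hπL ℓ ι ⟨r, hrss, hr⟩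
  · exact hG K n hcpt hn π hπ hsp ℓ ι

/-- **`closes`** — the deciding theorem of the child route: the pieces imply the TARGET G by name (every binder used). -/
theorem closes (hG : InsolubleDarkAvatars) (hU : ConjugateUnmixing) (hInd : InducedPreAvatar)
    (hAcc : RootDecomp1.AccessibleAvatars) (hD : RootDecomp1.AvatarDescent) (hT : RootDecomp1.RestrictionTwistTransport)
    (hI : RootDecomp1.InductionTransport) (hV : RootDecomp1.DualTransport) : RootDecomp1.DarkPrimitiveAvatars :=
  darkPrimitive_of_semisimpleAvatar (semisimpleAvatar_of_pieces hG hU hInd hAcc hD hT hI hV)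

/-- The Assembly of the carve holds by the kernel `closes` (pure logic). [folklore] -/
theorem assembly_holds : Assembly := fun hG hU hInd hAcc hD hT hI hV => closes hG hU hInd hAcc hD hT hI hV

/-- Root link: through the host's Assembly item (RootDecomp1, by name) the pieces decide `Langlands`. -/
theorem closes_root (hA : RootDecomp1.Assembly) (hW : RootDecomp1.WeakGeometricAutomorphy)
    (hIrr : RootDecomp1.CuspidalAvatarIrreducible) (hP : RootDecomp1.PadicMemberCompatibility)
    (hS : RootDecomp1.SatakePlacesAllData) (hR : RootDecomp1.RecRigidity) (hM : RootDecomp1.SemisimpleMatchingOneDatum)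
    (hGF : RootDecomp1.GenericFibre) (hRP : RootDecomp1.RecPreservesGenericity) (hWD : RootDecomp1.GenericWDUnique)
    (hC : RootDecomp1.CanonicalReciprocityData)
    (hG : InsolubleDarkAvatars) (hU : ConjugateUnmixing) (hInd : InducedPreAvatar)
    (hAcc : RootDecomp1.AccessibleAvatars) (hD : RootDecomp1.AvatarDescent) (hT : RootDecomp1.RestrictionTwistTransport)
    (hI : RootDecomp1.InductionTransport) (hV : RootDecomp1.DualTransport) : _root_.Langlands :=
  hA hW (semisimpleAvatar_of_pieces hG hU hInd hAcc hD hT hI hV) hIrr hP hS hR hM hGF hRP hWD hC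

/-! ## The ONE EQUIV (lens-3) and the exactness of the enlarged carving -/

/-- **`darkPrimitive_iff_pieces`** — the certified translation: modulo the host's five transports, the dark residual G is
EQUIVALENT to «insolubly dark residual ∧ the (ai↓) transport pair».  (→) uses the LANDED host glue
`Theorems.SemisimpleAvatar_of_split_proof` (G ∧ host ⇒ E) and the necessity certificates; (←) is `closes`. -/
theorem darkPrimitive_iff_pieces (hAcc : RootDecomp1.AccessibleAvatars) (hD : RootDecomp1.AvatarDescent)
    (hT : RootDecomp1.RestrictionTwistTransport) (hI : RootDecomp1.InductionTransport) (hV : RootDecomp1.DualTransport) :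
    RootDecomp1.DarkPrimitiveAvatars ↔ (InsolubleDarkAvatars ∧ ConjugateUnmixing ∧ InducedPreAvatar) := by
  constructor
  · intro hG
    have hE : RootDecomp1.SemisimpleAvatar := Theorems.SemisimpleAvatar_of_split_proof hG hAcc hD hT hI hV
    exact ⟨insolubleDark_of_semisimpleAvatar hE, unmixing_of_semisimpleAvatar hE, inducedPreAvatar_of_semisimpleAvatar hE⟩
  · rintro ⟨hG, hU, hInd⟩
    exact closes hG hU hInd hAcc hD hT hI hV

/-- **Exactness of the enlarged carving of E** (no «modulo»): E ⟺ the eight pieces. -/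
theorem semisimpleAvatar_iff_pieces :
    RootDecomp1.SemisimpleAvatar ↔ (InsolubleDarkAvatars ∧ ConjugateUnmixing ∧ InducedPreAvatar ∧
      RootDecomp1.AccessibleAvatars ∧ RootDecomp1.AvatarDescent ∧ RootDecomp1.RestrictionTwistTransport ∧
      RootDecomp1.InductionTransport ∧ RootDecomp1.DualTransport) :=
  ⟨fun hE => ⟨insolubleDark_of_semisimpleAvatar hE, unmixing_of_semisimpleAvatar hE, inducedPreAvatar_of_semisimpleAvatar hE,
    accessible_of_semisimpleAvatar hE, avatarDescent_of_semisimpleAvatar hE, restrictionTwist_of_semisimpleAvatar hE,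
    induction_of_semisimpleAvatar hE, dual_of_semisimpleAvatar hE⟩,
   fun ⟨hG, hU, hInd, hAcc, hD, hT, hI, hV⟩ => semisimpleAvatar_of_pieces hG hU hInd hAcc hD hT hI hV⟩

/-- The summit implies every piece (via E). -/
theorem pieces_of_langlands (hL : _root_.Langlands) (hE_of_L : _root_.Langlands → RootDecomp1.SemisimpleAvatar) :
    InsolubleDarkAvatars ∧ ConjugateUnmixing ∧ InducedPreAvatar :=
  ⟨insolubleDark_of_semisimpleAvatar (hE_of_L hL), unmixing_of_semisimpleAvatar (hE_of_L hL),
    inducedPreAvatar_of_semisimpleAvatar (hE_of_L hL)⟩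

/-! ## BC5 — the first rung of UNMIX, PROVED: no unmixing is needed away from the split places -/

/-- **First rung of `ConjugateUnmixing`.**  If r is a pre-avatar of π for the layer K/K₀ (the hypothesis of UNMIX, for any
automorphic π), then at all but finitely many places v of K₀ and every place w of K that is the ONLY place of K above v (inert
places; for a cyclic layer of prime degree these have density (p−1)/p among the places of K₀), r is Satake–Frobenius compatible
with π at w: the pre-avatar identity there reads Q_w(X^f) = P^{ι}_{π,w}(X^f) and X ↦ X^f is injective (`Polynomial.expand_inj`).
Hence the whole content of UNMIX sits at the split places, where the p conjugate places σ^i w can be interlaced. -/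
theorem preAvatar_compatible_of_unique_over {K₀ K : Type} [Field K₀] [NumberField K₀] [Field K] [NumberField K] [Algebra K₀ K]
    {m : ℕ} {hK : isCompact_glFiniteIntegralLevel m K} (π : AutomorphicRepData (AutomorphyDatum.gl m K hK))
    {ℓ : ℕ} [Fact ℓ.Prime] (ι : PadicAlgCl ℓ ≃+* ℂ) (r : FramedGaloisRep K (PadicAlgCl ℓ) m)
    (h : (∀ᶠ v : IsDedekindDomain.HeightOneSpectrum (NumberField.RingOfIntegers K₀) in cofinite, ∀ β : IsDedekindDomain.HeightOneSpectrum (NumberField.RingOfIntegers K) → Multiset ℂ, (∀ w : IsDedekindDomain.HeightOneSpectrum (NumberField.RingOfIntegers K), w.asIdeal.under (NumberField.RingOfIntegers K₀) = v.asIdeal → π.HasSatakeParamAt w (β w)) → ∃ Q : IsDedekindDomain.HeightOneSpectrum (NumberField.RingOfIntegers K) → Polynomial (PadicAlgCl ℓ), (∀ w : IsDedekindDomain.HeightOneSpectrum (NumberField.RingOfIntegers K), w.asIdeal.under (NumberField.RingOfIntegers K₀) = v.asIdeal → r.IsUnramifiedAt w ∧ r.HasFrobCharpolyAt w (Q w))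 ∧ ∏ᶠ w ∈ {w : IsDedekindDomain.HeightOneSpectrum (NumberField.RingOfIntegers K) | w.asIdeal.under (NumberField.RingOfIntegers K₀) = v.asIdeal}, (Q w).comp (Polynomial.X ^ w.asIdeal.inertiaDeg (NumberField.RingOfIntegers K₀)) = ∏ᶠ w ∈ {w : IsDedekindDomain.HeightOneSpectrum (NumberField.RingOfIntegers K) | w.asIdeal.under (NumberField.RingOfIntegers K₀) = v.asIdeal}, (Literature.NumberTheory.Automorphic.arithFrobPolyOfSatake ι w.residueCard 1 (β w)).comp (Polynomial.X ^ w.asIdeal.inertiaDeg (NumberField.RingOfIntegers K₀)))) :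
    ∀ᶠ v : HeightOneSpectrum (𝓞 K₀) in cofinite, ∀ w : HeightOneSpectrum (𝓞 K), w.asIdeal.under (𝓞 K₀) = v.asIdeal →
      (∀ w' : HeightOneSpectrum (𝓞 K), w'.asIdeal.under (𝓞 K₀) = v.asIdeal → w' = w) → SatakeFrobCompatibleAt ι π r w := by
  classical
  have hunr := eventually_forall_over (K₀ := K₀) (AutomorphicRepData.hasSatakeParamAt_cofinite_holds π)
  filter_upwards [h, hunr] with v hv hu
  intro w hw huniq
  have hex : ∀ w' : HeightOneSpectrum (𝓞 K), ∃ b : Multiset ℂ,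
      (w'.asIdeal.under (𝓞 K₀) = v.asIdeal → π.HasSatakeParamAt w' b) := by
    intro w'
    by_cases hw' : w'.asIdeal.under (𝓞 K₀) = v.asIdeal
    · obtain ⟨b, hb⟩ := hu w' hw'
      exact ⟨b, fun _ => hb⟩
    · exact ⟨0, fun h' => absurd h' hw'⟩
  choose β hβ using hex
  obtain ⟨Q, hQ, hprod⟩ := hv β hβ
  rw [finprod_cond_eq_single w hw huniq, finprod_cond_eq_single w hw huniq] at hprod
  have hf : 0 < w.asIdeal.inertiaDeg (𝓞 K₀) := Ideal.inertiaDeg_pos _ _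
  have hQeq : Q w = arithFrobPolyOfSatake ι w.residueCard 1 (β w) := by
    rw [← Polynomial.expand_eq_comp_X_pow, ← Polynomial.expand_eq_comp_X_pow] at hprod
    exact (Polynomial.expand_inj hf).mp hprod
  obtain ⟨hur, hch⟩ := hQ w hw
  exact ⟨β w, hβ w hw, hur, hQeq ▸ hch⟩

/-- **S-case of the BC5 rung's regime** (for `tribunal check … --s-case`): direction (A) itself — semisimple a.e. avatars for EVERY
cuspidal L-algebraic π on GL_m over a field K that is Galois, cyclic of prime degree over some subfield K₀ (all m, all weights; e.g. every
quadratic, cyclic cubic, … field).  NOT a theorem (open: it contains the irregular π over real quadratic fields and every π over the top of a dark cyclic prime layer, e.g.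
K = ℚ(∛2, ζ₃) over K₀ = ℚ(ζ₃), or K = K₀(√d) for any dark K₀);
the rung `preAvatar_compatible_of_unique_over` proves the INERT-PLACE TRUNCATION of UNMIX in exactly this regime, which is why it is a witness
of weakness and not a restatement. -/
def RungSCase : Prop :=
  ∀ (K₀ : Type) [Field K₀] [NumberField K₀] (K : Type) [Field K] [NumberField K] [Algebra K₀ K],
    IsGalois K₀ K → IsCyclic (K ≃ₐ[K₀] K) → (Module.finrank K₀ K).Prime →
    ∀ (m : ℕ) (hK : isCompact_glFiniteIntegralLevel m K), 0 < m → ∀ (π : CuspidalAutomorphicRepData m K hK), π.1.IsLAlgebraic →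
    ∀ (ℓ : ℕ) [Fact ℓ.Prime] (ι : PadicAlgCl ℓ ≃+* ℂ),
    ∃ ρ : FramedGaloisRep K (PadicAlgCl ℓ) m, ρ.toGaloisRep.IsSemisimple ∧
      ∀ᶠ w : HeightOneSpectrum (𝓞 K) in cofinite, SatakeFrobCompatibleAt ι π.1 ρ w

/-- E ⇒ the S-case (it is a restriction of E); recorded so the tribunal sees the S-case is on the summit's side. -/
theorem rungSCase_of_semisimpleAvatar (hE : RootDecomp1.SemisimpleAvatar) : RungSCase :=
  fun K₀ _ _ K _ _ _ _ _ _ m hK hm π hπL ℓ _ ι => hE K m hK hm π hπL ℓ ι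

end Summit.Langlands.Langlands.Theorems.CyclicDeinduction
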